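import Summits.ResolutionOfSingularities.ResolutionOfSingularities.Theorems.UniformComplexityPrimeModelTransferSpecializationLemmas
import Literature.AlgebraicGeometry.Resolution.ChowLemmaRing
import Summits.ResolutionOfSingularities.ResolutionOfSingularities.Theorems.UniformComplexityPrimeModelTransferAlgClosedTower
import Summits.ResolutionOfSingularities.ResolutionOfSingularities.Theorems.UniformComplexityCampaignW82SpecializationNormalForms
import Literature.AlgebraicGeometry.Limits.ProjectiveSubschemeDescent
import Literature.AlgebraicGeometry.Limits.ClosedSubschemes
import Literature.AlgebraicGeometry.Limits.SubalgebraDiagram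
import Literature.AlgebraicGeometry.Limits.GenericSmoothnessSpread
import Literature.AlgebraicGeometry.Morphisms.ReducedOfFlat
import Mathlib.FieldTheory.IsAlgClosed.AlgebraicClosure
import Mathlib.FieldTheory.AlgebraicClosure
import Mathlib.Algebra.CharP.IntermediateField
import Mathlib.AlgebraicGeometry.Morphisms.Flat
import Summits.ResolutionOfSingularities.ResolutionOfSingularities.Theorems.UniformComplexityCampaignW82FamilyResolution
import HarnessLib

/-!
# Crux `PrimeModelTransfer` (stmt-ResolutionOfSingularities-8933), door 2 of slot W8.2:
# RESOLUTION IN FAMILIES over the prime model ⇒ the crux («⇐» of the family form)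

Route `ResolutionOfSingularities/UniformComplexity`, crux `PrimeModelTransfer` (for a prime `p`:
resolution of integral separated finite-type schemes over the algebraically closed fields algebraic
over `𝔽_p` ⇒ the same over EVERY algebraically closed field of characteristic `p`). The route thesis
reads the crux as a UNIFORMITY statement («informally equivalent, via ACF_p-completeness and
compactness, to a uniform bound on resolution complexity over 𝔽̄_p»); the OURS module
`Theorems/UniformComplexityCampaignW82FamilyResolution.lean` (p526769) types that uniformity WITHOUT
model theory as `CampaignW82.FamilyResolution k` — every proper family over a finitely generated
`k`-domain with integral geometric generic fibre admits, after a finite-type ALGEBRAIC injective base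
extension `A → A'`, ONE morphism `G : 𝒴 → 𝒳 ×_A Spec A'` all of whose field-valued fibres are weak
resolutions (`CampaignW82.IsWeakResolution`: proper, regular source, isomorphism over a non-empty
open). THIS FILE proves the direction «family resolution ⇒ crux»:

* `exists_isPullback_proper_subalgebra` — a PROJECTIVE scheme over a field `K ⊇ k` is the fibre
  `X' ×_{Spec R} Spec K` of a PROPER family `X' → Spec R` over a finitely generated `k`-subalgebra
  `R ⊆ K` (EGA IV₃ 8.8.2 (ii); Görtz–Wedhorn I (10.13) + Prop. 10.75 (1): the closed subscheme
  `Y ↪ ℙⁿ_K = lim_t ℙⁿ_k ×_k Spec k[t]` descends to its scheme-theoretic image at a finite stage —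
  the tree's `SubalgApprox.isLimitProdCone` and `Limits.exists_isPullback_toImage_of_isLocallyNoetherian`,
  exactly as in `Limits.exists_isPullback_specMap_of_isNoetherianRing` but with `ℙⁿ_k` as the ambient
  model, which makes the descended model PROPER for free);
* `hasResolution_of_familyResolution` — **`FamilyResolution k` ⇒ every integral separated
  finite-type scheme over every ALGEBRAICALLY CLOSED `K ⊇ k` has a resolution** (Nagata + Chow
  reduce to projective `Y`, `hasResolution_of_forall_isProjOver`, p487985; the geometric generic
  fibre of the proper model is integral because `(Frac R)^{alg}` embeds into `K` over `R` and `Y`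
  is its flat surjective base change; the `K`-point `R ⊆ K` LIFTS along the algebraic extension
  `A'` by `IsAlgClosed.lift`; the fibre of `G` at the lift is a weak resolution of a scheme
  isomorphic to `Y`, whence `Scheme.HasResolution Y` by `hasResolution_of_isIso_morphismRestrict`,
  p483756);
* `algClosedRes_of_familyResolution` — for `k` of characteristic `p` algebraic over `𝔽_p` (the
  crux's elementwise clause), `FamilyResolution k → CampaignW82.AlgClosedRes p`;
* `primeModelTransferAt_of_familyResolution` — **BY NAME: if resolution over each prime model `k`
  implies `FamilyResolution k`, then `CampaignW82.PrimeModelTransferAt p`** (the `p`-slice of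
  `Theses.UniformComplexity.PrimeModelTransfer` by `Iff.rfl`, p488474).

The converse («crux ⇒ family resolution over every field of characteristic `p`», the spreading of
a resolution of the geometric generic fibre over an open of the base) is the sibling file
`Theorems/UniformComplexityPrimeModelTransferFamilyResolutionSpread.lean`.

[OURS · LADDER-RESOLUTION L1, slot W8.2 (prime-field / universality transfer), door 2
UniformComplexity] Theorems over the summit's own route and OURS names; NOT statements of, and
attributing nothing to, Hironaka's 2017 manuscript (the OURS `Prop`s replace the role of §17 ¶2,
p.89 l.59–62, see the definition module). AI-written; weaker than expert review. Barrier
bookkeeping: no resolution is base-changed along an inseparable field extension; the only descent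
used is flat-surjective descent of reducedness/irreducibility, and the only lift is of a `K`-point
along an ALGEBRAIC extension of finitely generated domains (`IsAlgClosed.lift`).

Sources: A. Grothendieck, J. Dieudonné, EGA IV₃ (1966) Thm. 8.8.2 (ii); U. Görtz, T. Wedhorn,
*Algebraic Geometry I* (2nd ed. 2020) (10.13), Prop. 10.75 (1); The Stacks Project, Tags 01ZM,
09GU (`IsAlgClosed.lift`). [cite: EGAIV3, Thm. 8.8.2 (ii)] [cite: GortzWedhorn2020, Prop. 10.75 (1)]
[cite: StacksProject, Tag 01ZM]
-/

noncomputable section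

set_option linter.dupNamespace false -- mandated namespace of this single-conjunct summit

open CategoryTheory CategoryTheory.Limits AlgebraicGeometry TopologicalSpace
open Literature.AlgebraicGeometry.Resolution

namespace Summit.ResolutionOfSingularities.ResolutionOfSingularities.Theorems.PrimeModelTransfer

open MonoidalCategory CartesianMonoidalCategory
open Literature.AlgebraicGeometry.Limits
open Literature.AlgebraicGeometry.Motives (SchemeOver specOver projectiveSpace)

set_option backward.isDefEq.respectTransparency false

/-! ## A projective variety over `K` is the fibre of a PROPER family over a finitely generated
`k`-subalgebra of `K` -/

/-- **Proper model over a finitely generated subalgebra.** Let `k ⊆ K` be fields and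
`g : Y → Spec K` projective (a closed `K`-immersion `Y ↪ ℙⁿ_K`). Then there are a finitely
generated `k`-subalgebra `R ⊆ K` (returned as a finite-type `k`-domain `R` with an injective ring
map `ψ : R → K`), a PROPER `R`-scheme `F : X' → Spec R` and `π : Y → X'` with `(π, g; F, Spec ψ)`
cartesian, i.e. `Y = X' ×_{Spec R} Spec K`. Proof: `ℙⁿ_K = ℙⁿ_k ×_k Spec K`
is the limit of the `ℙⁿ_k ×_k Spec k[t]`, `t ⊆ K` finite (Görtz–Wedhorn (10.13), the tree's
`SubalgApprox.isLimitProdCone`); the closed subscheme `Y` is the base change of its scheme-theoretic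
image `X' ↪ ℙⁿ_k ×_k Spec k[t]` for `t` large (Görtz–Wedhorn Prop. 10.75 (1),
`exists_isPullback_toImage_of_isLocallyNoetherian`), and `X' → Spec k[t]` is proper as a closed
subscheme of a base change of `ℙⁿ_k → Spec k`. [cite: GortzWedhorn2020, Prop. 10.75 (1) and (10.13)]
[cite: EGAIV3, Thm. 8.8.2 (ii)] -/
theorem exists_isPullback_proper_subalgebra (k K : Type) [Field k] [Field K] [Algebra k K]
    {Y : Scheme.{0}} (g : Y ⟶ Spec (.of K))
    (hproj : ChowLemmaRing.IsProjOver (Over.mk g : SchemeOver K)) :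
    ∃ (R : Type) (_ : CommRing R) (_ : IsDomain R) (_ : Algebra k R) (ψ : R →+* K)
      (X' : Scheme.{0}) (F : X' ⟶ Spec (.of R)) (π : Y ⟶ X'),
      Function.Injective ψ ∧ Algebra.FiniteType k R ∧ IsProper F ∧
        IsPullback π g F (Spec.map (CommRingCat.ofHom ψ)) := by
  classical
  obtain ⟨n, ι, hι⟩ := hproj
  haveI := hι
  -- `ℙⁿ_K ≅ Spec K ×_k ℙⁿ_k`
  obtain ⟨eK, heK⟩ := exists_iso_projectiveSpace_pullback k n K
  let P : SchemeOver k := projectiveSpace n k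
  haveI : IsProper P.hom := Literature.AlgebraicGeometry.Motives.isProper_projectiveSpace n k
  haveI : QuasiCompact P.hom := inferInstance
  haveI : IsSeparated P.hom := inferInstance
  haveI : LocallyOfFiniteType P.hom := inferInstance
  haveI : QuasiSeparated P.hom := inferInstance
  -- the limit presentation `ℙⁿ_k ×_k Spec K = lim_t ℙⁿ_k ×_k Spec k[t]`
  let D := SubalgApprox.prodDiagram k K (∅ : Finset K) P
  let c := SubalgApprox.prodCone k K (∅ : Finset K) P
  have hc : IsLimit c := SubalgApprox.isLimitProdCone k K ∅ P
  have hpt : c.pt = pullback P.hom (Spec.map (CommRingCat.ofHom (algebraMap k K))) := rfl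
  -- the closed immersion `j : Y ↪ ℙⁿ_k ×_k Spec K` over `Spec K`
  let j : Y ⟶ c.pt :=
    ι.left ≫ eK.hom ≫ (pullbackSymmetry (Spec.map (CommRingCat.ofHom (algebraMap k K))) P.hom).hom
  haveI : IsClosedImmersion j := by
    change IsClosedImmersion (ι.left ≫ eK.hom ≫ (pullbackSymmetry _ _).hom)
    infer_instance
  have hjg : j ≫ pullback.snd P.hom (specOver k K).hom = g := by
    have e1 : (pullbackSymmetry (Spec.map (CommRingCat.ofHom (algebraMap k K))) P.hom).hom ≫
        pullback.snd P.hom (Spec.map (CommRingCat.ofHom (algebraMap k K))) =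
          pullback.fst (Spec.map (CommRingCat.ofHom (algebraMap k K))) P.hom :=
      pullbackSymmetry_hom_comp_snd _ _
    have e2 : ι.left ≫ (projectiveSpace n K).hom = g := Over.w ι
    calc j ≫ pullback.snd P.hom (specOver k K).hom
        = ι.left ≫ eK.hom ≫ ((pullbackSymmetry (Spec.map (CommRingCat.ofHom (algebraMap k K)))
            P.hom).hom ≫ pullback.snd P.hom (Spec.map (CommRingCat.ofHom (algebraMap k K)))) := by
          simp only [j, Category.assoc]; rfl
      _ = ι.left ≫ (eK.hom ≫ pullback.fst (Spec.map (CommRingCat.ofHom (algebraMap k K))) P.hom) := by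
          rw [e1]
      _ = g := by rw [heK]; exact e2
  -- the limit is locally Noetherian: of finite type over the field `K`
  haveI : IsLocallyNoetherian c.pt := by
    rw [hpt]
    exact LocallyOfFiniteType.isLocallyNoetherian
      (pullback.snd P.hom (Spec.map (CommRingCat.ofHom (algebraMap k K))))
  -- the closed subscheme `Y` comes from a finite stage `t`
  obtain ⟨t, ht⟩ := exists_isPullback_toImage_of_isLocallyNoetherian D c hc j
  have hsq := ht t (𝟙 t)
  let R : Subalgebra k K := SubalgApprox.sub k K t.unop.1
  let πt : c.pt ⟶ D.obj t := c.π.app t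
  let X' : Scheme.{0} := (j ≫ πt).image
  let ι' : X' ⟶ D.obj t := (j ≫ πt).imageι
  let q : D.obj t ⟶ Spec (.of R) := pullback.snd P.hom ((SubalgApprox.baseDiagram k K ∅).obj t).hom
  haveI : IsProper q := inferInstanceAs (IsProper (pullback.snd P.hom _))
  haveI : IsClosedImmersion ι' := inferInstanceAs (IsClosedImmersion (j ≫ πt).imageι)
  refine ⟨R, inferInstance, inferInstance, inferInstance, R.val.toRingHom, X', ι' ≫ q, (j ≫ πt).toImage,
    fun x y h ↦ Subtype.ext h, SubalgApprox.finiteType_sub k K t.unop.1, inferInstance, ?_⟩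
  -- paste the image square with the base-change square over `Spec K → Spec k[t]`
  have h2 : IsPullback πt (pullback.snd P.hom (specOver k K).hom) q
      ((SubalgApprox.baseCone k K ∅).π.app t).left :=
    SubalgApprox.isPullback_whiskerLeft_left P ((SubalgApprox.baseCone k K ∅).π.app t)
  have h12 := hsq.flip.paste_vert h2
  rw [hjg] at h12
  exact h12

/-! ## Resolution in families over `k` ⇒ resolution over every algebraically closed `K ⊇ k` -/

/-- **FAMILY RESOLUTION over `k` implies resolution over every algebraically closed extension
`K` of `k`.** Let `k ⊆ K` be fields with `K` algebraically closed and assume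
`CampaignW82.FamilyResolution k`. Then every integral separated `K`-scheme of finite type has a
resolution. Proof: by Nagata and Chow it suffices to
treat an integral PROJECTIVE `Y → Spec K` (`hasResolution_of_forall_proper`, p483756, and the tree's
`ChowLemmaRing.chow_proper` with `Scheme.HasResolution.of_isBirational`); it is the fibre `Y = X' ×_R Spec K` of a proper family
`F : X' → Spec R` over a finitely generated `k`-subalgebra `R ⊆ K`
(`exists_isPullback_proper_subalgebra`); the geometric generic fibre `X' ×_R Spec (Frac R)^{alg}`
is integral, because `(Frac R)^{alg}` embeds into `K` over `R` (`IsAlgClosed.lift`) and `Y` is its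
flat surjective base change; `FamilyResolution k` gives an algebraic finite-type injective
`R → A'` and `G : 𝒴 → X' ×_R Spec A'` with weakly resolved fibres; the `K`-point `R ⊆ K` LIFTS to
`τ : A' → K` (`IsAlgClosed.lift`, `A'` algebraic over `R`), the fibre of `X' ×_R Spec A'` at `τ`
is `Y` again, and the fibre of `G` there — proper, regular source, an isomorphism over a non-empty
open of the irreducible `Y` — yields a resolution of `Y`
(`hasResolution_of_isIso_morphismRestrict`, p483756). No hypothesis on `k` (no resolution over
`k` is used): the content is all in `FamilyResolution k`. [cite: EGAIV3, Thm. 8.8.2 (ii)]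
[cite: StacksProject, Tag 01ZM] -/
theorem hasResolution_of_familyResolution (k K : Type) [Field k] [Field K] [IsAlgClosed K]
    [Algebra k K] (hFR : CampaignW82.FamilyResolution k)
    (X : Scheme.{0}) (f : X ⟶ Spec (.of K)) [IsSeparated f] [LocallyOfFiniteType f]
    [QuasiCompact f] [IsIntegral X] : Scheme.HasResolution X := by
  classical
  -- ### Step 0: it suffices to resolve integral PROJECTIVE `K`-schemes (Nagata + Chow)
  refine hasResolution_of_forall_proper K (fun Y₀ g₀ hg₀ hY₀ => ?_) X f
  haveI := hg₀
  haveI := hY₀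
  obtain ⟨n, Y, ρ, ι, hY, hι, hρ, -, hw, U, hUd, hUpre, hUiso⟩ :=
    ChowLemmaRing.chow_proper (R := K) Y₀ g₀
  haveI := hρ
  haveI := hι
  haveI := hY
  let g : Y ⟶ Spec (.of K) := ρ ≫ g₀
  have hproj : ChowLemmaRing.IsProjOver (Over.mk g : SchemeOver K) := ⟨n, Over.homMk ι hw, hι⟩
  refine Scheme.HasResolution.of_isBirational ρ ⟨U, hUd, hUpre, hUiso⟩ ?_
  -- ### Step 1: a proper model `F : X' → Spec R` over a finitely generated `k`-subalgebra `R ⊆ K`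
  obtain ⟨R, _, _, _, ψ, X', F, π, hψ, hRft, hF, hsq⟩ :=
    exists_isPullback_proper_subalgebra k K g hproj
  haveI := hRft
  haveI := hF
  letI : Algebra R K := ψ.toAlgebra
  haveI : FaithfulSMul R K := (faithfulSMul_iff_algebraMap_injective R K).mpr hψ
  -- ### Step 2: the geometric generic fibre `X' ×_R Spec (Frac R)^alg` is integral
  let L : Type := AlgebraicClosure (FractionRing R)
  haveI : Algebra.IsAlgebraic R (FractionRing R) :=
    IsLocalization.isAlgebraic (FractionRing R) (nonZeroDivisors R)
  haveI : Algebra.IsAlgebraic R L := Algebra.IsAlgebraic.trans R (FractionRing R) L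
  haveI : FaithfulSMul R L := (faithfulSMul_iff_algebraMap_injective R L).mpr (by
    rw [IsScalarTower.algebraMap_eq R (FractionRing R) L]
    exact (algebraMap (FractionRing R) L).injective.comp (IsFractionRing.injective R (FractionRing R)))
  let σ : L →ₐ[R] K := IsAlgClosed.lift
  have hσ : σ.toRingHom.comp (algebraMap R L) = ψ := σ.comp_algebraMap
  let iL : Spec (.of L) ⟶ Spec (.of R) := Spec.map (CommRingCat.ofHom (algebraMap R L))
  let jσ : Spec (.of K) ⟶ Spec (.of L) := Spec.map (CommRingCat.ofHom σ.toRingHom)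
  have hjσ : jσ ≫ iL = Spec.map (CommRingCat.ofHom ψ) := by
    change Spec.map _ ≫ Spec.map _ = _
    rw [← Spec.map_comp, ← CommRingCat.ofHom_comp, hσ]
  let XL : Scheme.{0} := pullback F iL
  let FL : XL ⟶ Spec (.of L) := pullback.snd F iL
  let m : Y ⟶ XL := pullback.lift π (g ≫ jσ) (by rw [Category.assoc, hjσ]; exact hsq.w)
  have hsqm : IsPullback m g FL jσ := by
    have outer : IsPullback (m ≫ pullback.fst F iL) g F (jσ ≫ iL) := by
      rw [pullback.lift_fst, hjσ]; exact hsq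
    exact outer.of_right (pullback.lift_snd _ _ _) (IsPullback.of_hasPullback F iL)
  haveI : Subsingleton ↥(Spec (CommRingCat.of L)) := inferInstanceAs (Subsingleton (PrimeSpectrum L))
  haveI : Subsingleton ↥(Spec (CommRingCat.of K)) := inferInstanceAs (Subsingleton (PrimeSpectrum K))
  haveI : Nonempty ↥(Spec (CommRingCat.of K)) := inferInstanceAs (Nonempty (PrimeSpectrum K))
  haveI : Flat jσ := by
    letI : Algebra L K := σ.toRingHom.toAlgebra
    haveI hflat : Module.Flat L K := inferInstance
    rw [show jσ = Spec.map (CommRingCat.ofHom (algebraMap L K)) from rfl, Flat.SpecMap_iff,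
      CommRingCat.hom_ofHom]
    exact RingHom.flat_algebraMap_iff.mpr hflat
  haveI : Surjective jσ := inferInstance
  haveI : Flat m := MorphismProperty.of_isPullback (P := @Flat) hsqm.flip ‹Flat jσ›
  haveI : Surjective m := MorphismProperty.of_isPullback (P := @Surjective) hsqm.flip ‹Surjective jσ›
  haveI : IsReduced XL := Literature.AlgebraicGeometry.Morphisms.isReduced_of_flat_of_surjective m
  haveI : IrreducibleSpace XL := Function.Surjective.irreducibleSpace m.continuous m.surjective
  have hint : IsIntegral XL := isIntegral_of_irreducibleSpace_of_isReduced XL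
  -- ### Step 3: the simultaneous weak resolution over an algebraic finite-type extension `A'`
  obtain ⟨A', _, _, _, hinj, -, halg, 𝒴, G, hG⟩ := hFR R hRft X' F hF hint
  -- ### Step 4: the `K`-point `R ⊆ K` lifts to `τ : A' → K`
  haveI : FaithfulSMul R A' := (faithfulSMul_iff_algebraMap_injective R A').mpr hinj
  let τ : A' →ₐ[R] K := IsAlgClosed.lift
  have hτ : τ.toRingHom.comp (algebraMap R A') = ψ := τ.comp_algebraMap
  let ιA : Spec (.of A') ⟶ Spec (.of R) := Spec.map (CommRingCat.ofHom (algebraMap R A'))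
  let F' : pullback F ιA ⟶ Spec (.of A') := pullback.snd F ιA
  let cτ : Spec (.of K) ⟶ Spec (.of A') := Spec.map (CommRingCat.ofHom τ.toRingHom)
  have hcτ : cτ ≫ ιA = Spec.map (CommRingCat.ofHom ψ) := by
    change Spec.map _ ≫ Spec.map _ = _
    rw [← Spec.map_comp, ← CommRingCat.ofHom_comp, hτ]
  -- ### Step 5: the fibre of `G` at `τ` is a weak resolution of `(X' ×_R A') ×_{A'} K ≅ Y`
  obtain ⟨hGp, hreg, W, hWne, hWiso⟩ := hG K τ.toRingHom
  let Xτ : Scheme.{0} := pullback F' cτ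
  let Gτ : pullback G (pullback.fst F' cτ) ⟶ Xτ := pullback.snd G (pullback.fst F' cτ)
  haveI : IsProper Gτ := hGp
  haveI : IsIso (Gτ ∣_ W) := hWiso
  let e : Xτ ≅ Y :=
    pullbackLeftPullbackSndIso F ιA cτ ≪≫ pullback.congrHom rfl hcτ ≪≫ hsq.isoPullback.symm
  haveI : IrreducibleSpace Xτ :=
    Function.Surjective.irreducibleSpace e.inv.continuous e.inv.surjective
  let pτ : Xτ ⟶ Spec (.of K) := pullback.snd F' cτ
  haveI : IsProper pτ := inferInstance
  haveI : IsNoetherian (pullback G (pullback.fst F' cτ)) := isNoetherian_of_locallyOfFiniteType (Gτ ≫ pτ)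
  exact Scheme.HasResolution.of_iso e.hom (hasResolution_of_isIso_morphismRestrict Gτ hreg W hWne)

/-! ## The crux slice from family resolution over the prime model -/

/-- **Family resolution over a prime model gives resolution over ALL algebraically closed fields
of characteristic `p`** (`CampaignW82.AlgClosedRes p`, the conclusion block of the crux). If `k` is
a field algebraic over `ZMod p` (e.g. `AlgebraicClosure (ZMod p)`, or any field satisfying the crux's
clause «every `x : k` has `x ^ p ^ n = x` for some `n ≥ 1`») with `CampaignW82.FamilyResolution k`,
then every integral
separated scheme of finite type over every algebraically closed `K` of characteristic `p` has a
resolution: `k` embeds into `K` (`IsAlgClosed.lift`) and `hasResolution_of_familyResolution`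
applies to `k ⊆ K`. No resolution hypothesis on `k` is needed. [folklore] -/
theorem algClosedRes_of_familyResolution (p : ℕ) [Fact p.Prime] (k : Type) [Field k]
    [Algebra (ZMod p) k] [Algebra.IsAlgebraic (ZMod p) k] (hFR : CampaignW82.FamilyResolution k) :
    CampaignW82.AlgClosedRes p := by
  intro K _ _ _ X f hs hl hq hX
  letI : Algebra (ZMod p) K := ZMod.algebra K p
  let ι : k →ₐ[ZMod p] K := IsAlgClosed.lift
  letI : Algebra k K := ι.toRingHom.toAlgebra
  exact hasResolution_of_familyResolution k K hFR X f

/-- **«⇐» of the family form of the crux, BY NAME.** For a prime `p`: if for every algebraically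
closed field `k` of characteristic `p` algebraic over `𝔽_p` (the crux's hypothesis fields, all
isomorphic to `𝔽̄_p`), resolution of the integral separated finite-type `k`-schemes implies
RESOLUTION IN FAMILIES over `k` (`CampaignW82.FamilyResolution k`), then the crux slice
`CampaignW82.PrimeModelTransferAt p` (`PrimeClosureRes p → AlgClosedRes p`; by `Iff.rfl` the
`p`-slice of `Theses.UniformComplexity.PrimeModelTransfer`, p488474) holds. Proof: at
`k = AlgebraicClosure (ZMod p)` (whose elements satisfy the clause, `pow_prime_pow_eq_self_of_isAlgebraic`,
p470438) the crux hypothesis gives resolution over `k`, hence `FamilyResolution k`, hence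
`AlgClosedRes p` (`algClosedRes_of_familyResolution`). [folklore] -/
theorem primeModelTransferAt_of_familyResolution {p : ℕ} (hp : p.Prime)
    (h : ∀ (k : Type) [Field k] [CharP k p] [IsAlgClosed k], (∀ x : k, ∃ n : ℕ, 0 < n ∧ x ^ p ^ n = x) →
      (∀ (X : Scheme.{0}) (f : X ⟶ Spec (.of k)), IsSeparated f → LocallyOfFiniteType f →
          QuasiCompact f → IsIntegral X → Scheme.HasResolution X) →
      CampaignW82.FamilyResolution k) :
    CampaignW82.PrimeModelTransferAt p := by
  intro hPC
  haveI : Fact p.Prime := ⟨hp⟩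
  let k₀ : Type := AlgebraicClosure (ZMod p)
  haveI : CharP k₀ p := charP_of_injective_algebraMap (algebraMap (ZMod p) k₀).injective p
  have hk₀ : ∀ x : k₀, ∃ n : ℕ, 0 < n ∧ x ^ p ^ n = x := fun x =>
    pow_prime_pow_eq_self_of_isAlgebraic p x (Algebra.IsAlgebraic.isAlgebraic x)
  exact algClosedRes_of_familyResolution p k₀ (h k₀ hk₀ (hPC k₀ hk₀))

end Summit.ResolutionOfSingularities.ResolutionOfSingularities.Theorems.PrimeModelTransfer

end
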